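import Literature.Analysis.FluidPDE.PeriodicLerayLimitGradient
import HarnessLib

/-!
# [BT1] proof of Theorem 2.4, the limit `ε → 0`, IX: time periodicity of the limits

Analysis/FluidPDE proof file (theorems only, no new definitions, no named facts), ninth part of
the discharge of the named fact `Literature.Analysis.FluidPDE.bradshawTsai2017_thm_2_4_limit`
(`PeriodicLerayExistence.lean`; Bradshaw–Tsai, Ann. Henri Poincaré 18 (2017) =
arXiv:1510.07504 [BT1], §2, proof of Thm 2.4). The approximants `U_k`, `p_k` are `T`-periodic
in `s`; their limits inherit periodicity almost everywhere: the strong `L²_loc` limit `U` because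
the time shift `(s, y) ↦ (s + c, y)` preserves Lebesgue measure and maps cylinders into cylinders
(`ae_comp_timeShift_eq_of_limit`), the weak `L^{5/3}_loc` limit `p` because the shifted test
functions are again admissible (`ae_comp_timeShift_eq_of_weak_limit`); consequently the
periodisations `U(T·fract(s/T), y)`, `p(T·fract(s/T), y)` — literally `T`-periodic — agree with
`U`, `p` a.e. (`ae_periodize_eq`), which provides the periodic representatives required by
Def. 2.3 (`IsSuitablePeriodicWeakSolution.periodic`, `.periodic_pressure`).

## References

* Z. Bradshaw, T.-P. Tsai, Ann. Henri Poincaré 18 (2017) 1095–1119 = arXiv:1510.07504, §2,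
  Def. 2.3 and proof of Thm 2.4 [BradshawTsai2017AHP].
-/

noncomputable section

open MeasureTheory TopologicalSpace Set Function Filter Metric Bornology
open scoped NNReal ENNReal Topology InnerProductSpace RealInnerProductSpace

namespace Literature.Analysis.FluidPDE

namespace BradshawTsai2017

/-! ### The time shift on `ℝ × ℝ³` -/

section TimeShift

/-- **The time shift `(s, y) ↦ (s + c, y)` preserves Lebesgue measure on `ℝ × ℝ³`.** [folklore] -/
theorem measurePreserving_timeShift (c : ℝ) :
    MeasurePreserving (fun z : ℝ × EuclideanSpace ℝ (Fin 3) => (z.1 + c, z.2))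
      (volume : Measure (ℝ × EuclideanSpace ℝ (Fin 3))) volume := by
  have h := (measurePreserving_add_right (volume : Measure ℝ) c).prod
    (MeasurePreserving.id (volume : Measure (EuclideanSpace ℝ (Fin 3))))
  rw [← Measure.volume_eq_prod] at h
  exact h

/-- The time shift is a measurable embedding (a homeomorphism). [folklore] -/
theorem measurableEmbedding_timeShift (c : ℝ) :
    MeasurableEmbedding (fun z : ℝ × EuclideanSpace ℝ (Fin 3) => (z.1 + c, z.2)) :=
  ((Homeomorph.addRight c).prodCongr (Homeomorph.refl (EuclideanSpace ℝ (Fin 3)))).measurableEmbedding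

/-- **Lower integrals over a cylinder of a time-shifted density are bounded by the lower
integral over any cylinder containing the shifted one.** [folklore] -/
theorem setLIntegral_comp_timeShift_le {f : ℝ × EuclideanSpace ℝ (Fin 3) → ℝ≥0∞}
    (hf : AEMeasurable f (volume : Measure (ℝ × EuclideanSpace ℝ (Fin 3)))) (c : ℝ)
    {S S' : Set (ℝ × EuclideanSpace ℝ (Fin 3))} (hS : MeasurableSet S) (hS' : MeasurableSet S')
    (hsub : ∀ z ∈ S, (z.1 + c, z.2) ∈ S') :
    ∫⁻ z in S, f (z.1 + c, z.2) ≤ ∫⁻ z in S', f z := by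
  have hτ := measurePreserving_timeShift c
  set g : ℝ × EuclideanSpace ℝ (Fin 3) → ℝ≥0∞ := S'.indicator f with hg
  have hgm : AEMeasurable g (Measure.map (fun z : ℝ × EuclideanSpace ℝ (Fin 3) => (z.1 + c, z.2)) volume) := by
    rw [hτ.map_eq]; exact hf.indicator hS'
  calc ∫⁻ z in S, f (z.1 + c, z.2) = ∫⁻ z, S.indicator (fun z : ℝ × EuclideanSpace ℝ (Fin 3) => f (z.1 + c, z.2)) z :=
        (lintegral_indicator hS (fun z : ℝ × EuclideanSpace ℝ (Fin 3) => f (z.1 + c, z.2))).symm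
    _ ≤ ∫⁻ z : ℝ × EuclideanSpace ℝ (Fin 3), g (z.1 + c, z.2) := by
        refine lintegral_mono fun z => ?_
        by_cases hz : z ∈ S
        · rw [indicator_of_mem hz, hg, indicator_of_mem (hsub z hz)]
        · rw [indicator_of_notMem hz]; exact zero_le
    _ = ∫⁻ w, g w ∂(Measure.map (fun z : ℝ × EuclideanSpace ℝ (Fin 3) => (z.1 + c, z.2)) volume) :=
        (lintegral_map' hgm hτ.measurable.aemeasurable).symm
    _ = ∫⁻ z in S', f z := by rw [hτ.map_eq, hg, lintegral_indicator hS']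

/-- **Strong `L²_loc` limits of time-periodic fields are a.e. invariant under the period shift.**
If `U_k(s + c, y) = U_k(s, y)` for all `k, s, y` and `U_k → U` in `L²` of every cylinder
`Q_n = (−n−1, n+1) × B(0, n+1)`, then `U(s + c, y) = U(s, y)` for a.e. `(s, y)`: on `Q_n`,
`‖U∘τ_c − U‖ ≤ ‖(U − U_k)∘τ_c‖ + ‖U_k − U‖`, and `∫_{Q_n} ‖(U − U_k)∘τ_c‖² ≤ ∫_{Q_{n'}} ‖U − U_k‖²`
for `Q_{n'} ⊇ τ_c(Q_n)` since `τ_c` preserves Lebesgue measure. [folklore] -/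
theorem ae_comp_timeShift_eq_of_limit {F : Type*} [NormedAddCommGroup F]
    {U : ℕ → ℝ → EuclideanSpace ℝ (Fin 3) → F} {Ul : ℝ → EuclideanSpace ℝ (Fin 3) → F}
    (hUm : ∀ k, AEStronglyMeasurable (uncurry (U k)) (volume : Measure (ℝ × EuclideanSpace ℝ (Fin 3))))
    {c : ℝ} (hper : ∀ k s y, U k (s + c) y = U k s y)
    (hUlm : AEStronglyMeasurable (uncurry Ul) (volume : Measure (ℝ × EuclideanSpace ℝ (Fin 3))))
    (hconv : ∀ n : ℕ, Tendsto (fun k => ∫⁻ z in Ioo (-((n : ℝ) + 1)) ((n : ℝ) + 1) ×ˢ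
        ball (0 : EuclideanSpace ℝ (Fin 3)) (n + 1), ‖U k z.1 z.2 - Ul z.1 z.2‖ₑ ^ 2) atTop (𝓝 0)) :
    ∀ᵐ z : ℝ × EuclideanSpace ℝ (Fin 3), Ul (z.1 + c) z.2 = Ul z.1 z.2 := by
  have hτ := measurePreserving_timeShift c
  set Q : ℕ → Set (ℝ × EuclideanSpace ℝ (Fin 3)) := fun n =>
    Ioo (-((n : ℝ) + 1)) ((n : ℝ) + 1) ×ˢ ball (0 : EuclideanSpace ℝ (Fin 3)) (n + 1) with hQ
  have hQm : ∀ n, MeasurableSet (Q n) := fun n => measurableSet_Ioo.prod measurableSet_ball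
  -- the shifted measurability
  have hUlτ : AEStronglyMeasurable (fun z : ℝ × EuclideanSpace ℝ (Fin 3) => Ul (z.1 + c) z.2) volume :=
    hUlm.comp_measurePreserving hτ
  -- on each cylinder
  have hwin : ∀ n : ℕ, ∀ᵐ z : ℝ × EuclideanSpace ℝ (Fin 3), z ∈ Q n → Ul (z.1 + c) z.2 = Ul z.1 z.2 := by
    intro n
    set n' : ℕ := n + ⌈|c|⌉₊ with hn'
    have hsub : ∀ z ∈ Q n, (z.1 + c, z.2) ∈ Q n' := by
      intro z hz
      have hc : |c| ≤ (⌈|c|⌉₊ : ℝ) := Nat.le_ceil _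
      have hn'r : (n' : ℝ) = n + ⌈|c|⌉₊ := by rw [hn']; push_cast; ring
      refine ⟨⟨?_, ?_⟩, ball_subset_ball (by rw [hn'r]; linarith [Nat.cast_nonneg (α := ℝ) ⌈|c|⌉₊]) hz.2⟩
      · rw [hn'r]; linarith [hz.1.1, neg_abs_le c]
      · rw [hn'r]; linarith [hz.1.2, le_abs_self c]
    -- `∫_{Q n} ‖Ul∘τ − Ul‖² ≤ 2 ∫_{Q n'} ‖Ul − U_k‖² + 2 ∫_{Q n} ‖U_k − Ul‖²` for every `k`
    have hbd : ∀ k, ∫⁻ z in Q n, ‖Ul (z.1 + c) z.2 - Ul z.1 z.2‖ₑ ^ 2 ≤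
        2 * (∫⁻ z in Q n', ‖U k z.1 z.2 - Ul z.1 z.2‖ₑ ^ 2) + 2 * ∫⁻ z in Q n, ‖U k z.1 z.2 - Ul z.1 z.2‖ₑ ^ 2 := by
      intro k
      have hpt : ∀ z : ℝ × EuclideanSpace ℝ (Fin 3), ‖Ul (z.1 + c) z.2 - Ul z.1 z.2‖ₑ ^ 2 ≤
          2 * (‖U k (z.1 + c) z.2 - Ul (z.1 + c) z.2‖ₑ ^ 2 + ‖U k z.1 z.2 - Ul z.1 z.2‖ₑ ^ 2) := by
        intro z
        have e : Ul (z.1 + c) z.2 - Ul z.1 z.2 = (U k z.1 z.2 - Ul z.1 z.2) - (U k (z.1 + c) z.2 - Ul (z.1 + c) z.2) := by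
          rw [hper k z.1 z.2]; abel
        rw [e]
        calc ‖(U k z.1 z.2 - Ul z.1 z.2) - (U k (z.1 + c) z.2 - Ul (z.1 + c) z.2)‖ₑ ^ 2
            ≤ 2 * (‖U k z.1 z.2 - Ul z.1 z.2‖ₑ ^ 2 + ‖U k (z.1 + c) z.2 - Ul (z.1 + c) z.2‖ₑ ^ 2) :=
              FunctionSpaces.AubinLions.enorm_sub_sq_le _ _
          _ = 2 * (‖U k (z.1 + c) z.2 - Ul (z.1 + c) z.2‖ₑ ^ 2 + ‖U k z.1 z.2 - Ul z.1 z.2‖ₑ ^ 2) := by rw [add_comm]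
      have hm : AEMeasurable (fun z : ℝ × EuclideanSpace ℝ (Fin 3) => ‖U k (z.1 + c) z.2 - Ul (z.1 + c) z.2‖ₑ ^ 2)
          (volume.restrict (Q n)) :=
        ((((hUm k).comp_measurePreserving hτ).sub hUlτ).enorm.pow_const 2).restrict
      calc ∫⁻ z in Q n, ‖Ul (z.1 + c) z.2 - Ul z.1 z.2‖ₑ ^ 2
          ≤ ∫⁻ z in Q n, 2 * (‖U k (z.1 + c) z.2 - Ul (z.1 + c) z.2‖ₑ ^ 2 + ‖U k z.1 z.2 - Ul z.1 z.2‖ₑ ^ 2) :=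
            lintegral_mono fun z => hpt z
        _ = 2 * ((∫⁻ z in Q n, ‖U k (z.1 + c) z.2 - Ul (z.1 + c) z.2‖ₑ ^ 2) + ∫⁻ z in Q n, ‖U k z.1 z.2 - Ul z.1 z.2‖ₑ ^ 2) := by
            rw [lintegral_const_mul' _ _ ENNReal.ofNat_ne_top, lintegral_add_left' hm]
        _ ≤ 2 * ((∫⁻ z in Q n', ‖U k z.1 z.2 - Ul z.1 z.2‖ₑ ^ 2) + ∫⁻ z in Q n, ‖U k z.1 z.2 - Ul z.1 z.2‖ₑ ^ 2) := by
            have h := setLIntegral_comp_timeShift_le (f := fun z : ℝ × EuclideanSpace ℝ (Fin 3) => ‖U k z.1 z.2 - Ul z.1 z.2‖ₑ ^ 2)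
              (((hUm k).sub hUlm).enorm.pow_const 2) c (hQm n) (hQm n') hsub
            dsimp only at h
            exact mul_le_mul_right (add_le_add h le_rfl) 2
        _ = 2 * (∫⁻ z in Q n', ‖U k z.1 z.2 - Ul z.1 z.2‖ₑ ^ 2) + 2 * ∫⁻ z in Q n, ‖U k z.1 z.2 - Ul z.1 z.2‖ₑ ^ 2 := by ring
    have hlim : Tendsto (fun k => 2 * (∫⁻ z in Q n', ‖U k z.1 z.2 - Ul z.1 z.2‖ₑ ^ 2) +
        2 * ∫⁻ z in Q n, ‖U k z.1 z.2 - Ul z.1 z.2‖ₑ ^ 2) atTop (𝓝 0) := by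
      have h1 := ENNReal.Tendsto.const_mul (hconv n') (a := 2) (Or.inr ENNReal.ofNat_ne_top)
      have h2 := ENNReal.Tendsto.const_mul (hconv n) (a := 2) (Or.inr ENNReal.ofNat_ne_top)
      rw [mul_zero] at h1 h2
      have h := h1.add h2
      rwa [add_zero] at h
    have hzero : ∫⁻ z in Q n, ‖Ul (z.1 + c) z.2 - Ul z.1 z.2‖ₑ ^ 2 = 0 :=
      le_antisymm (ge_of_tendsto' hlim hbd) (zero_le)
    have hm0 : AEMeasurable (fun z : ℝ × EuclideanSpace ℝ (Fin 3) => ‖Ul (z.1 + c) z.2 - Ul z.1 z.2‖ₑ ^ 2) (volume.restrict (Q n)) :=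
      ((hUlτ.sub hUlm).enorm.pow_const 2).restrict
    have hae : ∀ᵐ z ∂(volume.restrict (Q n)), ‖Ul (z.1 + c) z.2 - Ul z.1 z.2‖ₑ ^ 2 = (0 : ℝ × EuclideanSpace ℝ (Fin 3) → ℝ≥0∞) z :=
      (lintegral_eq_zero_iff' hm0).1 hzero
    rw [ae_restrict_iff' (hQm n)] at hae
    filter_upwards [hae] with z hz hzQ
    have h := hz hzQ
    simp only [Pi.zero_apply, pow_eq_zero_iff two_ne_zero, enorm_eq_zero, sub_eq_zero] at h
    exact h
  -- glue the cylinders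
  have hall := ae_all_iff.2 hwin
  filter_upwards [hall] with z hz
  set n : ℕ := max ⌈|z.1|⌉₊ ⌈‖z.2‖⌉₊ with hn
  refine hz n ⟨⟨?_, ?_⟩, ?_⟩
  · have h1 : |z.1| ≤ n := (Nat.le_ceil |z.1|).trans (by exact_mod_cast le_max_left _ _)
    linarith [neg_abs_le z.1]
  · have h1 : |z.1| ≤ n := (Nat.le_ceil |z.1|).trans (by exact_mod_cast le_max_left _ _)
    linarith [le_abs_self z.1]
  · rw [mem_ball_zero_iff]
    have h2 : ‖z.2‖ ≤ n := (Nat.le_ceil ‖z.2‖).trans (by exact_mod_cast le_max_right _ _)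
    linarith

/-- **Weak `L^{5/3}_loc` limits of time-periodic pressures are a.e. invariant under the period
shift.** If `p_k(s + c, y) = p_k(s, y)`, `p` is locally integrable, and
`∫_Q p_k h → ∫_Q p h` for every cylinder `Q = (a,b) × B(0,R)` and `h ∈ L^{5/2}(Q)`, then
`p(s + c, y) = p(s, y)` a.e.: testing with `h` on `Q` and with `h ∘ τ_{−c}` on `τ_c(Q)` (again a
cylinder, again an `L^{5/2}` test function since `τ_c` preserves Lebesgue measure) gives
`∫_Q (p∘τ_c − p) h = 0` for all bounded `h`. [folklore] -/
theorem ae_comp_timeShift_eq_of_weak_limit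
    {p : ℕ → ℝ → EuclideanSpace ℝ (Fin 3) → ℝ} {pl : ℝ → EuclideanSpace ℝ (Fin 3) → ℝ}
    {c : ℝ} (hper : ∀ k s y, p k (s + c) y = p k s y)
    (hpli : ∀ a b R : ℝ, IntegrableOn (uncurry pl) (Ioo a b ×ˢ ball (0 : EuclideanSpace ℝ (Fin 3)) R) volume)
    (hpw : ∀ (a b R : ℝ) (h : ℝ × EuclideanSpace ℝ (Fin 3) → ℝ),
      MemLp h (5 / 2 : ℝ≥0∞) (volume.restrict (Ioo a b ×ˢ ball (0 : EuclideanSpace ℝ (Fin 3)) R)) →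
      Tendsto (fun k => ∫ z in Ioo a b ×ˢ ball (0 : EuclideanSpace ℝ (Fin 3)) R, p k z.1 z.2 * h z) atTop
        (𝓝 (∫ z in Ioo a b ×ˢ ball (0 : EuclideanSpace ℝ (Fin 3)) R, pl z.1 z.2 * h z))) :
    ∀ᵐ z : ℝ × EuclideanSpace ℝ (Fin 3), pl (z.1 + c) z.2 = pl z.1 z.2 := by
  have hτ := measurePreserving_timeShift c
  have hτe := measurableEmbedding_timeShift c
  have hτi := measurePreserving_timeShift (-c)
  have hτie := measurableEmbedding_timeShift (-c)
  set Q : ℕ → Set (ℝ × EuclideanSpace ℝ (Fin 3)) := fun n =>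
    Ioo (-((n : ℝ) + 1)) ((n : ℝ) + 1) ×ˢ ball (0 : EuclideanSpace ℝ (Fin 3)) (n + 1) with hQ
  have hQm : ∀ n, MeasurableSet (Q n) := fun n => measurableSet_Ioo.prod measurableSet_ball
  have hwin : ∀ n : ℕ, ∀ᵐ z : ℝ × EuclideanSpace ℝ (Fin 3), z ∈ Q n → pl (z.1 + c) z.2 = pl z.1 z.2 := by
    intro n
    set a : ℝ := -((n : ℝ) + 1) with ha
    set b : ℝ := (n : ℝ) + 1 with hb
    set R : ℝ := (n : ℝ) + 1 with hR
    set S : Set (ℝ × EuclideanSpace ℝ (Fin 3)) := Ioo a b ×ˢ ball (0 : EuclideanSpace ℝ (Fin 3)) R with hS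
    set S' : Set (ℝ × EuclideanSpace ℝ (Fin 3)) := Ioo (a + c) (b + c) ×ˢ ball (0 : EuclideanSpace ℝ (Fin 3)) R with hS'
    have hSm : MeasurableSet S := measurableSet_Ioo.prod measurableSet_ball
    have hpre : (fun z : ℝ × EuclideanSpace ℝ (Fin 3) => (z.1 + c, z.2)) ⁻¹' S' = S := by
      ext z
      simp only [mem_preimage, hS', hS, mem_prod, mem_Ioo, add_lt_add_iff_right]
    have hpre' : (fun w : ℝ × EuclideanSpace ℝ (Fin 3) => (w.1 + -c, w.2)) ⁻¹' S = S' := by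
      ext w
      simp only [mem_preimage, hS', hS, mem_prod, mem_Ioo]
      constructor
      · rintro ⟨⟨h1, h2⟩, h3⟩; exact ⟨⟨by linarith, by linarith⟩, h3⟩
      · rintro ⟨⟨h1, h2⟩, h3⟩; exact ⟨⟨by linarith, by linarith⟩, h3⟩
    haveI : IsFiniteMeasure (volume.restrict S) :=
      NSCylinder.isFiniteMeasure_restrict (Ω := ⟨ball (0 : EuclideanSpace ℝ (Fin 3)) R, isOpen_ball⟩) isBounded_ball a b
    -- integrability of `pl` and `pl ∘ τ` on `S`
    have hplS : IntegrableOn (fun z : ℝ × EuclideanSpace ℝ (Fin 3) => pl z.1 z.2) S volume := hpli a b R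
    have hplτS : IntegrableOn (fun z : ℝ × EuclideanSpace ℝ (Fin 3) => pl (z.1 + c) z.2) S volume := by
      have h := (hτ.integrableOn_comp_preimage hτe (f := uncurry pl) (s := S')).2 (hpli (a + c) (b + c) R)
      rw [hpre] at h
      exact h
    -- change of variables for the tested integrals
    have hcv : ∀ (q : ℝ → EuclideanSpace ℝ (Fin 3) → ℝ) (h : ℝ × EuclideanSpace ℝ (Fin 3) → ℝ),
        ∫ z in S, q (z.1 + c) z.2 * h z = ∫ w in S', q w.1 w.2 * h (w.1 + -c, w.2) := by
      intro q h
      have e := hτ.setIntegral_preimage_emb hτe (fun w : ℝ × EuclideanSpace ℝ (Fin 3) => q w.1 w.2 * h (w.1 + -c, w.2)) S'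
      rw [hpre] at e
      rw [← e]
      refine integral_congr_ae (Eventually.of_forall fun z => ?_)
      simp only [add_neg_cancel_right]
    -- the shifted test functions are admissible
    have hmem' : ∀ {h : ℝ × EuclideanSpace ℝ (Fin 3) → ℝ}, MemLp h (5 / 2 : ℝ≥0∞) (volume.restrict S) →
        MemLp (fun w : ℝ × EuclideanSpace ℝ (Fin 3) => h (w.1 + -c, w.2)) (5 / 2 : ℝ≥0∞) (volume.restrict S') := by
      intro h hh
      have hres := hτi.restrict_preimage_emb hτie S
      rw [hpre'] at hres
      exact hh.comp_measurePreserving hres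
    -- `∫_S (pl∘τ − pl) h = 0` for every `h ∈ L^{5/2}(S)`
    have horth : ∀ (h : ℝ × EuclideanSpace ℝ (Fin 3) → ℝ), MemLp h (5 / 2 : ℝ≥0∞) (volume.restrict S) →
        ∫ z in S, pl (z.1 + c) z.2 * h z = ∫ z in S, pl z.1 z.2 * h z := by
      intro h hh
      have t1 := hpw a b R h hh
      have t2 : Tendsto (fun k => ∫ z in S, p k z.1 z.2 * h z) atTop (𝓝 (∫ z in S, pl (z.1 + c) z.2 * h z)) := by
        have e : ∀ k, ∫ z in S, p k z.1 z.2 * h z = ∫ w in S', p k w.1 w.2 * h (w.1 + -c, w.2) := by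
          intro k
          rw [← hcv (p k) h]
          refine integral_congr_ae (Eventually.of_forall fun z => ?_)
          show p k z.1 z.2 * h z = p k (z.1 + c) z.2 * h z
          rw [hper k]
        simp only [e, hcv pl h]
        exact hpw (a + c) (b + c) R _ (hmem' hh)
      exact (tendsto_nhds_unique t2 t1)
    -- hence `pl∘τ = pl` a.e. on `S`
    set g : ℝ × EuclideanSpace ℝ (Fin 3) → ℝ := fun z => pl (z.1 + c) z.2 - pl z.1 z.2 with hg
    have hgi : Integrable g (volume.restrict S) := hplτS.sub hplS
    have hg0 : g =ᵐ[volume.restrict S] 0 := by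
      refine hgi.ae_eq_zero_of_forall_setIntegral_eq_zero fun A hA _ => ?_
      set h : ℝ × EuclideanSpace ℝ (Fin 3) → ℝ := A.indicator fun _ => (1 : ℝ) with hh
      have hhm : MemLp h (5 / 2 : ℝ≥0∞) (volume.restrict S) :=
        (memLp_top_of_bound ((aestronglyMeasurable_const (b := (1 : ℝ))).indicator hA) 1
          (Eventually.of_forall fun z => by
            by_cases hz : z ∈ A
            · rw [indicator_of_mem hz, norm_one]
            · rw [indicator_of_notMem hz, norm_zero]; exact zero_le_one)).mono_exponent le_top
      have e1 : ∫ z in A, g z ∂(volume.restrict S) = ∫ z in S, g z * h z := by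
        rw [← integral_indicator hA]
        refine integral_congr_ae (Eventually.of_forall fun z => ?_)
        show A.indicator g z = g z * h z
        rw [hh]
        by_cases hz : z ∈ A
        · rw [indicator_of_mem hz, indicator_of_mem hz, mul_one]
        · rw [indicator_of_notMem hz, indicator_of_notMem hz, mul_zero]
      have hbd : ∀ᵐ z ∂(volume.restrict S), ‖h z‖ ≤ 1 := Eventually.of_forall fun z => by
        rw [hh]; by_cases hz : z ∈ A
        · rw [indicator_of_mem hz, norm_one]
        · rw [indicator_of_notMem hz, norm_zero]; exact zero_le_one
      have hhm' : AEStronglyMeasurable h (volume.restrict S) := (aestronglyMeasurable_const (b := (1 : ℝ))).indicator hA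
      have hb1 : Integrable (fun z => pl (z.1 + c) z.2 * h z) (volume.restrict S) :=
        (hplτS.bdd_mul hhm' hbd).congr (Eventually.of_forall fun z => mul_comm _ _)
      have hb2 : Integrable (fun z => pl z.1 z.2 * h z) (volume.restrict S) :=
        (hplS.bdd_mul hhm' hbd).congr (Eventually.of_forall fun z => mul_comm _ _)
      rw [e1]
      have e2 : (fun z => g z * h z) = fun z => pl (z.1 + c) z.2 * h z - pl z.1 z.2 * h z := by
        funext z; rw [hg]; ring
      rw [e2, integral_sub hb1 hb2, horth h hhm, sub_self]
    rw [hg] at hg0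
    have hae : ∀ᵐ z ∂(volume.restrict S), pl (z.1 + c) z.2 - pl z.1 z.2 = (0 : ℝ × EuclideanSpace ℝ (Fin 3) → ℝ) z := hg0
    rw [ae_restrict_iff' hSm] at hae
    filter_upwards [hae] with z hz hzQ
    exact sub_eq_zero.1 (hz hzQ)
  -- glue the cylinders
  have hall := ae_all_iff.2 hwin
  filter_upwards [hall] with z hz
  set n : ℕ := max ⌈|z.1|⌉₊ ⌈‖z.2‖⌉₊ with hn
  refine hz n ⟨⟨?_, ?_⟩, ?_⟩
  · have h1 : |z.1| ≤ n := (Nat.le_ceil |z.1|).trans (by exact_mod_cast le_max_left _ _)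
    linarith [neg_abs_le z.1]
  · have h1 : |z.1| ≤ n := (Nat.le_ceil |z.1|).trans (by exact_mod_cast le_max_left _ _)
    linarith [le_abs_self z.1]
  · rw [mem_ball_zero_iff]
    have h2 : ‖z.2‖ ≤ n := (Nat.le_ceil ‖z.2‖).trans (by exact_mod_cast le_max_right _ _)
    linarith

end TimeShift

/-! ### Periodisation of a.e.-periodic fields -/

section Periodize

/-- **An a.e. shift-invariant field agrees a.e. with its periodisation**: if
`F(s + kT, y) = F(s, y)` a.e. for every `k ∈ ℤ`, then `F(T·fract(s/T), y) = F(s, y)` a.e.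
(`T·fract(s/T) = s − ⌊s/T⌋T`). [folklore] -/
theorem ae_periodize_eq {F' : Type*} {F : ℝ → EuclideanSpace ℝ (Fin 3) → F'} {T : ℝ} (hT : 0 < T)
    (h : ∀ k : ℤ, ∀ᵐ z : ℝ × EuclideanSpace ℝ (Fin 3), F (z.1 + k * T) z.2 = F z.1 z.2) :
    ∀ᵐ z : ℝ × EuclideanSpace ℝ (Fin 3), F (Int.fract (z.1 / T) * T) z.2 = F z.1 z.2 := by
  have hall := ae_all_iff.2 h
  filter_upwards [hall] with z hz
  rw [fract_div_mul_eq hT.ne']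
  exact hz _

/-- On the period window `[0, T)` the periodisation is the field itself. [folklore] -/
theorem periodize_eq_of_mem_Ico {X Y : Type*} {T : ℝ} (hT : 0 < T) (F : ℝ → X → Y) {s : ℝ} (hs : s ∈ Ico 0 T) (y : X) :
    F (Int.fract (s / T) * T) y = F s y := by
  have h1 : Int.fract (s / T) = s / T := by
    rw [Int.fract_eq_self]
    exact ⟨div_nonneg hs.1 hT.le, (div_lt_one hT).2 hs.2⟩
  rw [h1, div_mul_cancel₀ s hT.ne']

/-- A `T`-periodic time function takes at `s` its value at `T·fract(s/T) ∈ [0, T)`; hence the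
periodisation of a periodic field is the field. [folklore] -/
theorem periodize_eq_of_periodic {X Y : Type*} {T : ℝ} (hT : 0 < T) (F : ℝ → X → Y)
    (hper : ∀ s y, F (s + T) y = F s y) (s : ℝ) (y : X) :
    F (Int.fract (s / T) * T) y = F s y := by
  have hp : Function.Periodic (fun s => F s y) T := fun s => hper s y
  have h := hp.int_mul (-⌊s / T⌋) s
  rw [fract_div_mul_eq hT.ne']
  simpa using h

end Periodize

end BradshawTsai2017

end Literature.Analysis.FluidPDE

end
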